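import Mathlib
import Summits.AtomisticToContinuum.HydrodynamicLimit.Theorems.ImplosionDichotomyDenseExcursionPackingResolventInnerCases
import Summits.AtomisticToContinuum.HydrodynamicLimit.Theorems.ImplosionDichotomyDenseExcursionPackingResolventOuterCases

/-!
# The packing-resolvent gain: the global weighted maximum principle (one `θ` for four gauges)
# (crux `DenseExcursion`, stmt-AtomisticToContinuum-12586, line `sonic-cavity-renewal` v8, stub `stub_packingResolventW`)

Helper file (`--supports stmt-AtomisticToContinuum-12586`) for the registered stub `stub_packingResolventW` (skeleton v8;
registered helper here: `packingResolventW_etaLimit`). THE BARRIER BOUNDS FOR FIXED BARRIER PARAMETERS `ε, η`: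
`packingResolventW_gauges` — for a differentiable real solution of the real resolvent system at real `Λ ≥ Λ₀` with a
`(1 + S)`-weighted source of size `N` and FINITE global weighted sup (this is all that is used of centre-regularity), the
four gauges `|U|/Ū`, `|Z|/Z̄` on `x ≤ x_Λ` and `|P|/P̄`, `|M|/M̄` on `x ≥ x_Λ` are all `≤ 1`. Proof: each gauge is continuous
on its closed half-line and tends to `0` at its infinite end (the solution is bounded while `Ū, Z̄` grow like
`e^{−ε(x−x_Λ)}` and `P̄, M̄` like `ηeˣ`), so it attains its supremum (landed
`Literature.Analysis.ODE.exists_isMaxOn_Iic/Ici_of_tendsto_zero`); the largest of the four suprema, `θ`, dominates every gauge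
everywhere, and at the point where it is attained the landed case analyses `inner_cases` / `outer_cases` give `θ ≤ 1`.
Also here: the elementary `ε, η → 0` step (`packingResolventW_etaLimit`, `expSmall`) and its consequence
`packingResolventW_gaugesLimit`: the four bounds with the barrier parameters removed.
-/

noncomputable section

open Set Filter Topology

namespace Summit.AtomisticToContinuum.HydrodynamicLimit.Theorems.PackingAnalyticImplosion

/-- **Registered helper `packingResolventW_etaLimit` of `stub_packingResolventW`**: a bound `a ≤ b + tc` valid for all
`0 < t ≤ t₀` (`c ≥ 0`, `t₀ > 0`) gives `a ≤ b` — the `ε, η → 0` step of the barrier argument. [folklore] -/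
theorem packingResolventW_etaLimit : ∀ (a b c t₀ : ℝ), 0 ≤ c → 0 < t₀ → (∀ t : ℝ, 0 < t → t ≤ t₀ → a ≤ b + t * c) → a ≤ b := by
  intro a b c t₀ hc ht₀ h
  by_contra hcon
  push Not at hcon
  rcases eq_or_lt_of_le hc with h0 | h0
  · have := h t₀ ht₀ le_rfl
    rw [← h0, mul_zero, add_zero] at this
    linarith
  · set t : ℝ := min t₀ ((a - b) / (2 * c)) with ht
    have ht1 : 0 < t := lt_min ht₀ (by apply div_pos <;> linarith)
    have h1 := h t ht1 (min_le_left _ _)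
    have h2 : t * c ≤ (a - b) / (2 * c) * c := mul_le_mul_of_nonneg_right (min_le_right _ _) hc
    have h3 : (a - b) / (2 * c) * c = (a - b) / 2 := by field_simp
    linarith

/-- The largest of four reals is one of them. [folklore] -/
theorem max4_cases (a b c d : ℝ) :
    max (max a b) (max c d) = a ∨ max (max a b) (max c d) = b ∨ max (max a b) (max c d) = c ∨ max (max a b) (max c d) = d := by
  rcases max_choice (max a b) (max c d) with h | h <;> rw [h]
  · rcases max_choice a b with h' | h' <;> rw [h'] <;> simp
  · rcases max_choice c d with h' | h' <;> rw [h'] <;> simp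

/-- **THE FOUR BARRIER BOUNDS FOR FIXED `ε, η`.** Hypotheses: those of `inner_cases` and `outer_cases` without the
dominating number `θ` (it is constructed here), plus the finite global weighted sup `|u₁| + |u₂|/S ≤ N′` of the solution.
Conclusion: `|U| ≤ Ū`, `|Z| ≤ Z̄` on `x ≤ x_Λ` and `|P| ≤ P̄`, `|M| ≤ M̄` on `x ≥ x_Λ`. [folklore] -/
theorem packingResolventW_gauges (r Λ δ s₀ N N' ε η lam xL B₀ : ℝ) (W S u₁ u₂ f₁ f₂ Hf : ℝ → ℝ)
    (hr1 : 17307 / 15625 ≤ r) (hr2 : r ≤ 697 / 625) (hδΛ : δ * Λ = 1) (hδ : 0 < δ) (hδ' : δ ≤ 1 / 1000)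
    (hB : 1 ≤ B₀) (hΛB : 700 * B₀ ^ 2 ≤ Λ)
    (hs₀ : 7 / 10 ≤ s₀) (hs₀' : s₀ ≤ 1) (hxL : Real.exp xL = 2 * s₀ / Λ) (hN : 0 < N) (hε : 0 < ε) (hε' : ε ≤ 1 / 100)
    (hη : 0 < η) (hηN : η ≤ N / 100) (hSpos : ∀ x, 0 < S x) (hSd : Differentiable ℝ S)
    (hu₁ : Differentiable ℝ u₁) (hu₂ : Differentiable ℝ u₂)
    (htc : (∀ x, x ≤ 1 → |W x| ≤ 1 / 4 ∧ |deriv W x| ≤ 1 / 2 ∧ 7 / 10 ≤ Real.exp x * S x ∧ Real.exp x * S x ≤ 1))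
    (htd : (∀ x, x ≤ 0 → |W x - (r - 1)| ≤ Real.exp x ^ 2 / 10 + 2 * Real.exp x ^ 4 ∧ |deriv W x| ≤ Real.exp x ^ 2 / 5 + 2 * Real.exp x ^ 4 ∧ |Real.exp x * S x - s₀| ≤ Real.exp x ^ 2 / 10 + 2 * Real.exp x ^ 4 ∧ |Real.exp x * (S x + deriv S x)| ≤ Real.exp x ^ 2 / 5 + 2 * Real.exp x ^ 4))
    (hτ : ∀ x, x ≤ 0 → |S x + deriv S x| ≤ 11 / 5)
    (hsup : ∀ x, x < 0 → 1 < W x + S x) (hsub : ∀ x, 0 ≤ x → W x + S x ≤ 1)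
    (hB0 : ∀ x, 0 ≤ x → |W x| ≤ B₀ ∧ |deriv W x| ≤ B₀ ∧ S x ≤ B₀ ∧ |deriv S x| ≤ B₀)
    (hSanti : ∀ x y, x ≤ y → y ≤ 1 → S y ≤ S x)
    (heq : ∀ x, Λ * u₁ x - ((W x - 1) * deriv u₁ x + 3 * S x * deriv u₂ x + (deriv W x + 2 * W x - r) * u₁ x + (3 * deriv S x + 6 * S x) * u₂ x) = f₁ x ∧ Λ * u₂ x - (S x / 3 * deriv u₁ x + (W x - 1) * deriv u₂ x + (deriv S x + 2 * S x) * u₁ x + (deriv W x / 3 + 2 * W x - r) * u₂ x) = f₂ x)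
    (hf : ∀ y, |f₁ y| / (1 + S y) + |f₂ y| / S y ≤ N)
    (hN' : ∀ y, |u₁ y| + |u₂ y| / S y ≤ N')
    (hHd : ∀ x, x ≤ xL → HasDerivAt Hf (-(Λ * Real.exp x ^ 2 * S x * ((1 - W x) * f₂ x + S x * f₁ x / 3)) / (s₀ ^ 2 * (S x ^ 2 - (1 - W x) ^ 2))) x ∧ |Hf x| ≤ 7 / 10 * N) (hH0 : Hf xL = 0)
    (hlam : lam * (94253 / 51975) = (Λ * Real.exp xL ^ 2 * S xL * u₂ xL / s₀ ^ 2)) :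
    (∀ x, x ≤ xL → |(u₁ x - lam * (1 + (Λ / s₀ * Real.exp x) ^ 2 / 10 + (Λ / s₀ * Real.exp x) ^ 4 / 280 + (Λ / s₀ * Real.exp x) ^ 6 / 15120 + (Λ / s₀ * Real.exp x) ^ 8 / 1330560))| ≤ (9 * N * Real.exp (-(ε * (x - xL)))) ∧ |((Λ * Real.exp x ^ 2 * S x * u₂ x / s₀ ^ 2) - Hf x - lam * (1 + (Λ / s₀ * Real.exp x) ^ 2 / 6 + (Λ / s₀ * Real.exp x) ^ 4 / 120 + (Λ / s₀ * Real.exp x) ^ 6 / 5040 + (Λ / s₀ * Real.exp x) ^ 8 / 362880 + (Λ / s₀ * Real.exp x) ^ 10 / 39916800))| ≤ (17 / 10 * N * (401 / 100 - (Λ / s₀ * Real.exp x) ^ 2) * Real.exp (-(ε * (x - xL))))) ∧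
    (∀ x, xL ≤ x → |u₁ x + 3 * u₂ x| ≤ (N / Λ * (2 + 100 * S x) + η * Real.exp x) ∧ |u₁ x - 3 * u₂ x| ≤ (N / Λ * (2 + 75 * S x) + η * Real.exp x)) := by
  have hΛ : 1000 ≤ Λ := thousand_le_of_delta hδΛ hδ hδ'
  have hΛpos : 0 < Λ := by linarith
  have hs0 : 0 < s₀ := by linarith
  have hNΛ : 0 < N / Λ := div_pos hN hΛpos
  have hN'0 : 0 ≤ N' := le_trans (add_nonneg (abs_nonneg _) (div_nonneg (abs_nonneg _) (hSpos 0).le)) (hN' 0)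
  have hu1b : ∀ y, |u₁ y| ≤ N' := fun y => by
    have := hN' y; have : 0 ≤ |u₂ y| / S y := div_nonneg (abs_nonneg _) (hSpos y).le; linarith
  have hu2b : ∀ y, |u₂ y| ≤ N' * S y := fun y => by
    have h1 := hN' y
    have h2 : |u₂ y| / S y ≤ N' := by linarith [abs_nonneg (u₁ y)]
    rwa [div_le_iff₀ (hSpos y)] at h2
  have htc3 : ∀ x, x ≤ 1 → |W x| ≤ 1 / 4 ∧ 7 / 10 ≤ Real.exp x * S x ∧ Real.exp x * S x ≤ 1 :=
    fun x hx => ⟨(htc x hx).1, (htc x hx).2.2.1, (htc x hx).2.2.2⟩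
  have hxLneg : xL < 0 := by
    have h1 : Real.exp xL < 1 := by rw [hxL, div_lt_one hΛpos]; linarith
    exact Real.exp_lt_one_iff.1 h1
  -- ===== the four gauges =====
  set gU : ℝ → ℝ := fun x => |(u₁ x - lam * (1 + (Λ / s₀ * Real.exp x) ^ 2 / 10 + (Λ / s₀ * Real.exp x) ^ 4 / 280 + (Λ / s₀ * Real.exp x) ^ 6 / 15120 + (Λ / s₀ * Real.exp x) ^ 8 / 1330560))| / (9 * N * Real.exp (-(ε * (x - xL)))) with hgU
  set gZ : ℝ → ℝ := fun x => |((Λ * Real.exp x ^ 2 * S x * u₂ x / s₀ ^ 2) - Hf x - lam * (1 + (Λ / s₀ * Real.exp x) ^ 2 / 6 + (Λ / s₀ * Real.exp x) ^ 4 / 120 + (Λ / s₀ * Real.exp x) ^ 6 / 5040 + (Λ / s₀ * Real.exp x) ^ 8 / 362880 + (Λ / s₀ * Real.exp x) ^ 10 / 39916800))| / (17 / 10 * N * (401 / 100 - (Λ / s₀ * Real.exp x) ^ 2) * Real.exp (-(ε * (x - xL)))) with hgZ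
  set gP : ℝ → ℝ := fun x => |u₁ x + 3 * u₂ x| / (N / Λ * (2 + 100 * S x) + η * Real.exp x) with hgP
  set gM : ℝ → ℝ := fun x => |u₁ x - 3 * u₂ x| / (N / Λ * (2 + 75 * S x) + η * Real.exp x) with hgM
  have hUbpos : ∀ x, 0 < (9 * N * Real.exp (-(ε * (x - xL)))) := fun x => by positivity
  have hZbpos : ∀ x, x ≤ xL → 0 < (17 / 10 * N * (401 / 100 - (Λ / s₀ * Real.exp x) ^ 2) * Real.exp (-(ε * (x - xL)))) := fun x hx => by
    obtain ⟨-, -, -, -, -, -, -, -, -, -, -, -, -, h⟩ := inner_atoms_at hδΛ hδ hδ' hs₀ hs₀' hxL htc3 htd hx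
    have hx0 : 0 ≤ Λ / s₀ * Real.exp x := by positivity
    have hx4 : (Λ / s₀ * Real.exp x) ^ 2 ≤ 4 := by
      calc (Λ / s₀ * Real.exp x) ^ 2 ≤ (2:ℝ) ^ 2 := pow_le_pow_left₀ hx0 h 2
        _ = 4 := by norm_num
    have : 0 < 401 / 100 - (Λ / s₀ * Real.exp x) ^ 2 := by linarith
    positivity
  have hPbpos : ∀ x, 0 < (N / Λ * (2 + 100 * S x) + η * Real.exp x) := fun x => by have := hSpos x; positivity
  have hMbpos : ∀ x, 0 < (N / Λ * (2 + 75 * S x) + η * Real.exp x) := fun x => by have := hSpos x; positivity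
  -- continuity
  have hu₁c : Continuous u₁ := hu₁.continuous
  have hu₂c : Continuous u₂ := hu₂.continuous
  have hSc : Continuous S := hSd.continuous
  have hHc : ContinuousOn Hf (Iic xL) := fun x hx => (hHd x hx).1.continuousAt.continuousWithinAt
  have hgUc : ContinuousOn gU (Iic xL) := by
    apply Continuous.continuousOn
    simp only [hgU]
    refine Continuous.div (continuous_abs.comp (by fun_prop)) (by fun_prop) fun x => (hUbpos x).ne'
  have hgZc : ContinuousOn gZ (Iic xL) := by
    simp only [hgZ]
    refine ContinuousOn.div ?_ (Continuous.continuousOn (by fun_prop)) fun x hx => (hZbpos x hx).ne'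
    refine continuous_abs.comp_continuousOn ?_
    refine ContinuousOn.sub (ContinuousOn.sub (Continuous.continuousOn (by fun_prop)) hHc) (Continuous.continuousOn (by fun_prop))
  have hgPc : ContinuousOn gP (Ici xL) := by
    apply Continuous.continuousOn
    simp only [hgP]
    exact Continuous.div (continuous_abs.comp (by fun_prop)) (by fun_prop) fun x => (hPbpos x).ne'
  have hgMc : ContinuousOn gM (Ici xL) := by
    apply Continuous.continuousOn
    simp only [hgM]
    exact Continuous.div (continuous_abs.comp (by fun_prop)) (by fun_prop) fun x => (hMbpos x).ne'
  -- nonnegativity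
  have hgU0 : ∀ x ∈ Iic xL, 0 ≤ gU x := fun x _ => by simp only [hgU]; exact div_nonneg (abs_nonneg _) (hUbpos x).le
  have hgZ0 : ∀ x ∈ Iic xL, 0 ≤ gZ x := fun x hx => by simp only [hgZ]; exact div_nonneg (abs_nonneg _) (hZbpos x hx).le
  have hgP0 : ∀ x ∈ Ici xL, 0 ≤ gP x := fun x _ => by simp only [hgP]; exact div_nonneg (abs_nonneg _) (hPbpos x).le
  have hgM0 : ∀ x ∈ Ici xL, 0 ≤ gM x := fun x _ => by simp only [hgM]; exact div_nonneg (abs_nonneg _) (hMbpos x).le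
  -- sizes of the unknowns on the two regions
  have hUb : ∀ x, x ≤ xL → |(u₁ x - lam * (1 + (Λ / s₀ * Real.exp x) ^ 2 / 10 + (Λ / s₀ * Real.exp x) ^ 4 / 280 + (Λ / s₀ * Real.exp x) ^ 6 / 15120 + (Λ / s₀ * Real.exp x) ^ 8 / 1330560))| ≤ N' + |lam| * (147 / 100) := by
    intro x hx
    obtain ⟨-, -, -, -, -, -, -, -, -, -, -, -, hρ0, hρ2⟩ := inner_atoms_at hδΛ hδ hδ' hs₀ hs₀' hxL htc3 htd hx
    obtain ⟨-, -, -, hΨ1, hΨ2⟩ := besselPhi5_bounds hρ0.le hρ2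
    calc _ ≤ |u₁ x| + |lam * (1 + (Λ / s₀ * Real.exp x) ^ 2 / 10 + (Λ / s₀ * Real.exp x) ^ 4 / 280 + (Λ / s₀ * Real.exp x) ^ 6 / 15120 + (Λ / s₀ * Real.exp x) ^ 8 / 1330560)| := abs_sub _ _
      _ ≤ N' + |lam| * (147 / 100) := by
        rw [abs_mul, abs_of_nonneg (by linarith : (0:ℝ) ≤ (1 + (Λ / s₀ * Real.exp x) ^ 2 / 10 + (Λ / s₀ * Real.exp x) ^ 4 / 280 + (Λ / s₀ * Real.exp x) ^ 6 / 15120 + (Λ / s₀ * Real.exp x) ^ 8 / 1330560))]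
        exact add_le_add (hu1b x) (mul_le_mul_of_nonneg_left hΨ2 (abs_nonneg _))
  have hZb : ∀ x, x ≤ xL → |((Λ * Real.exp x ^ 2 * S x * u₂ x / s₀ ^ 2) - Hf x - lam * (1 + (Λ / s₀ * Real.exp x) ^ 2 / 6 + (Λ / s₀ * Real.exp x) ^ 4 / 120 + (Λ / s₀ * Real.exp x) ^ 6 / 5040 + (Λ / s₀ * Real.exp x) ^ 8 / 362880 + (Λ / s₀ * Real.exp x) ^ 10 / 39916800))| ≤ Λ * N' / s₀ ^ 2 + 7 / 10 * N + |lam| * (182 / 100) := by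
    intro x hx
    have hSx : 0 < S x := hSpos x
    obtain ⟨he, -, -, -, -, hst2, -, -, -, -, -, -, hρ0, hρ2⟩ := inner_atoms_at hδΛ hδ hδ' hs₀ hs₀' hxL htc3 htd hx
    obtain ⟨hΦ1, hΦ2, hΦ3, -, -⟩ := besselPhi5_bounds hρ0.le hρ2
    have hV : |(Λ * Real.exp x ^ 2 * S x * u₂ x / s₀ ^ 2)| ≤ Λ * N' / s₀ ^ 2 := by
      rw [abs_div, abs_of_pos (by positivity : (0:ℝ) < s₀ ^ 2), div_le_div_iff_of_pos_right (by positivity)]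
      rw [abs_mul, abs_of_pos (by positivity : (0:ℝ) < Λ * Real.exp x ^ 2 * S x)]
      have h1 : Λ * Real.exp x ^ 2 * S x * |u₂ x| ≤ Λ * Real.exp x ^ 2 * S x * (N' * S x) :=
        mul_le_mul_of_nonneg_left (hu2b x) (by positivity)
      have h2 : Λ * Real.exp x ^ 2 * S x * (N' * S x) = Λ * N' * (S x * Real.exp x) ^ 2 := by ring
      have h3 : (S x * Real.exp x) ^ 2 ≤ 1 := by
        have h0 : 0 ≤ S x * Real.exp x := by have := hSpos x; positivity
        calc (S x * Real.exp x) ^ 2 ≤ 1 ^ 2 := pow_le_pow_left₀ h0 hst2 2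
          _ = 1 := by ring
      have h4 : Λ * N' * (S x * Real.exp x) ^ 2 ≤ Λ * N' * 1 := mul_le_mul_of_nonneg_left h3 (by positivity)
      linarith
    calc _ ≤ |(Λ * Real.exp x ^ 2 * S x * u₂ x / s₀ ^ 2) - Hf x| + |lam * (1 + (Λ / s₀ * Real.exp x) ^ 2 / 6 + (Λ / s₀ * Real.exp x) ^ 4 / 120 + (Λ / s₀ * Real.exp x) ^ 6 / 5040 + (Λ / s₀ * Real.exp x) ^ 8 / 362880 + (Λ / s₀ * Real.exp x) ^ 10 / 39916800)| := abs_sub _ _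
      _ ≤ (|(Λ * Real.exp x ^ 2 * S x * u₂ x / s₀ ^ 2)| + |Hf x|) + |lam| * (182 / 100) := by
        refine add_le_add (abs_sub _ _) ?_
        rw [abs_mul, abs_of_nonneg (by linarith : (0:ℝ) ≤ (1 + (Λ / s₀ * Real.exp x) ^ 2 / 6 + (Λ / s₀ * Real.exp x) ^ 4 / 120 + (Λ / s₀ * Real.exp x) ^ 6 / 5040 + (Λ / s₀ * Real.exp x) ^ 8 / 362880 + (Λ / s₀ * Real.exp x) ^ 10 / 39916800))]
        exact mul_le_mul_of_nonneg_left (hΦ2.trans hΦ3) (abs_nonneg _)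
      _ ≤ _ := by linarith [(hHd x hx).2]
  have hPb : ∀ x, 0 ≤ x → |u₁ x + 3 * u₂ x| ≤ N' * (1 + 3 * B₀) ∧ |u₁ x - 3 * u₂ x| ≤ N' * (1 + 3 * B₀) := by
    intro x hx
    obtain ⟨-, -, hSB, -⟩ := hB0 x hx
    have h1 : |3 * u₂ x| ≤ 3 * (N' * B₀) := by
      rw [abs_mul, abs_of_pos (by norm_num : (0:ℝ) < 3)]
      exact mul_le_mul_of_nonneg_left ((hu2b x).trans (mul_le_mul_of_nonneg_left hSB hN'0)) (by norm_num)
    constructor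
    · calc _ ≤ |u₁ x| + |3 * u₂ x| := abs_add_le _ _
        _ ≤ N' * (1 + 3 * B₀) := by linarith [hu1b x]
    · calc _ ≤ |u₁ x| + |3 * u₂ x| := abs_sub _ _
        _ ≤ N' * (1 + 3 * B₀) := by linarith [hu1b x]
  -- limits at the infinite ends
  have hexp_top : Tendsto (fun x => Real.exp (-(ε * (x - xL)))) atBot atTop := by
    have h1 : Tendsto (fun x => -(ε * (x - xL))) atBot atTop := by
      refine tendsto_atBot_atTop.2 fun b => ⟨xL - b / ε, fun a ha => ?_⟩
      have h3 : ε * a ≤ ε * (xL - b / ε) := mul_le_mul_of_nonneg_left ha hε.le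
      have h4 : ε * (xL - b / ε) = ε * xL - b := by field_simp
      rw [h4] at h3
      linarith
    exact Real.tendsto_exp_atTop.comp h1
  have hgUlim : Tendsto gU atBot (𝓝 0) := by
    have h1 : Tendsto (fun x => (N' + |lam| * (147 / 100)) / (9 * N * Real.exp (-(ε * (x - xL))))) atBot (𝓝 0) :=
      tendsto_const_nhds.div_atTop (hexp_top.const_mul_atTop (by positivity))
    refine squeeze_zero' (Eventually.of_forall fun x => div_nonneg (abs_nonneg _) (hUbpos x).le) ?_ h1
    filter_upwards [eventually_le_atBot xL] with x hx
    exact div_le_div_of_nonneg_right (hUb x hx) (hUbpos x).le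
  have hgZlim : Tendsto gZ atBot (𝓝 0) := by
    have h1 : Tendsto (fun x => (Λ * N' / s₀ ^ 2 + 7 / 10 * N + |lam| * (182 / 100)) /
        (17 / 10 * N * (1 / 100) * Real.exp (-(ε * (x - xL))))) atBot (𝓝 0) :=
      tendsto_const_nhds.div_atTop (hexp_top.const_mul_atTop (by positivity))
    refine squeeze_zero' ?_ ?_ h1
    · filter_upwards [eventually_le_atBot xL] with x hx using div_nonneg (abs_nonneg _) (hZbpos x hx).le
    · filter_upwards [eventually_le_atBot xL] with x hx
      obtain ⟨-, -, -, -, -, -, -, -, -, -, -, -, hρ0, hρ2⟩ := inner_atoms_at hδΛ hδ hδ' hs₀ hs₀' hxL htc3 htd hx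
      have hlow : 17 / 10 * N * (1 / 100) * Real.exp (-(ε * (x - xL))) ≤ (17 / 10 * N * (401 / 100 - (Λ / s₀ * Real.exp x) ^ 2) * Real.exp (-(ε * (x - xL)))) := by
        apply mul_le_mul_of_nonneg_right _ (Real.exp_pos _).le
        apply mul_le_mul_of_nonneg_left _ (by positivity)
        have hx4 : (Λ / s₀ * Real.exp x) ^ 2 ≤ 4 := by
          calc (Λ / s₀ * Real.exp x) ^ 2 ≤ (2:ℝ) ^ 2 := pow_le_pow_left₀ hρ0.le hρ2 2
            _ = 4 := by norm_num
        linarith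
      calc gZ x = |((Λ * Real.exp x ^ 2 * S x * u₂ x / s₀ ^ 2) - Hf x - lam * (1 + (Λ / s₀ * Real.exp x) ^ 2 / 6 + (Λ / s₀ * Real.exp x) ^ 4 / 120 + (Λ / s₀ * Real.exp x) ^ 6 / 5040 + (Λ / s₀ * Real.exp x) ^ 8 / 362880 + (Λ / s₀ * Real.exp x) ^ 10 / 39916800))| / (17 / 10 * N * (401 / 100 - (Λ / s₀ * Real.exp x) ^ 2) * Real.exp (-(ε * (x - xL)))) := rfl
        _ ≤ |((Λ * Real.exp x ^ 2 * S x * u₂ x / s₀ ^ 2) - Hf x - lam * (1 + (Λ / s₀ * Real.exp x) ^ 2 / 6 + (Λ / s₀ * Real.exp x) ^ 4 / 120 + (Λ / s₀ * Real.exp x) ^ 6 / 5040 + (Λ / s₀ * Real.exp x) ^ 8 / 362880 + (Λ / s₀ * Real.exp x) ^ 10 / 39916800))| / (17 / 10 * N * (1 / 100) * Real.exp (-(ε * (x - xL)))) :=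
          div_le_div_of_nonneg_left (abs_nonneg _) (by positivity) hlow
        _ ≤ _ := div_le_div_of_nonneg_right (hZb x hx) (by positivity)
  have hηexp : Tendsto (fun x => η * Real.exp x) atTop atTop := Real.tendsto_exp_atTop.const_mul_atTop hη
  have hgPlim : Tendsto gP atTop (𝓝 0) := by
    have h1 : Tendsto (fun x => N' * (1 + 3 * B₀) / (η * Real.exp x)) atTop (𝓝 0) := tendsto_const_nhds.div_atTop hηexp
    refine squeeze_zero' (Eventually.of_forall fun x => div_nonneg (abs_nonneg _) (hPbpos x).le) ?_ h1
    filter_upwards [eventually_ge_atTop 0] with x hx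
    calc gP x = |u₁ x + 3 * u₂ x| / (N / Λ * (2 + 100 * S x) + η * Real.exp x) := rfl
      _ ≤ |u₁ x + 3 * u₂ x| / (η * Real.exp x) :=
        div_le_div_of_nonneg_left (abs_nonneg _) (by positivity) (by linarith [hNΛ, hSpos x, mul_pos hNΛ (hSpos x)])
      _ ≤ _ := div_le_div_of_nonneg_right (hPb x hx).1 (by positivity)
  have hgMlim : Tendsto gM atTop (𝓝 0) := by
    have h1 : Tendsto (fun x => N' * (1 + 3 * B₀) / (η * Real.exp x)) atTop (𝓝 0) := tendsto_const_nhds.div_atTop hηexp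
    refine squeeze_zero' (Eventually.of_forall fun x => div_nonneg (abs_nonneg _) (hMbpos x).le) ?_ h1
    filter_upwards [eventually_ge_atTop 0] with x hx
    calc gM x = |u₁ x - 3 * u₂ x| / (N / Λ * (2 + 75 * S x) + η * Real.exp x) := rfl
      _ ≤ |u₁ x - 3 * u₂ x| / (η * Real.exp x) :=
        div_le_div_of_nonneg_left (abs_nonneg _) (by positivity) (by linarith [hNΛ, hSpos x, mul_pos hNΛ (hSpos x)])
      _ ≤ _ := div_le_div_of_nonneg_right (hPb x hx).2 (by positivity)
  -- ===== the maxima and `θ` =====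
  obtain ⟨xU, hxU, hmU⟩ := Literature.Analysis.ODE.exists_isMaxOn_Iic_of_tendsto_zero hgUc hgU0 hgUlim
  obtain ⟨xZ, hxZ, hmZ⟩ := Literature.Analysis.ODE.exists_isMaxOn_Iic_of_tendsto_zero hgZc hgZ0 hgZlim
  obtain ⟨xP, hxP, hmP⟩ := Literature.Analysis.ODE.exists_isMaxOn_Ici_of_tendsto_zero hgPc hgP0 hgPlim
  obtain ⟨xM, hxM, hmM⟩ := Literature.Analysis.ODE.exists_isMaxOn_Ici_of_tendsto_zero hgMc hgM0 hgMlim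
  set θ : ℝ := max (max (gU xU) (gZ xZ)) (max (gP xP) (gM xM)) with hθ_def
  have hθU' : gU xU ≤ θ := le_trans (le_max_left _ _) (le_max_left _ _)
  have hθZ' : gZ xZ ≤ θ := le_trans (le_max_right _ _) (le_max_left _ _)
  have hθP' : gP xP ≤ θ := le_trans (le_max_left _ _) (le_max_right _ _)
  have hθM' : gM xM ≤ θ := le_trans (le_max_right _ _) (le_max_right _ _)
  have hθ0 : 0 ≤ θ := le_trans (hgU0 xU hxU) hθU'
  -- `θ` dominates every gauge
  have hθU : ∀ x, x ≤ xL → |(u₁ x - lam * (1 + (Λ / s₀ * Real.exp x) ^ 2 / 10 + (Λ / s₀ * Real.exp x) ^ 4 / 280 + (Λ / s₀ * Real.exp x) ^ 6 / 15120 + (Λ / s₀ * Real.exp x) ^ 8 / 1330560))| ≤ θ * (9 * N * Real.exp (-(ε * (x - xL)))) := fun x hx => by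
    have h1 : gU x ≤ θ := (hmU (mem_Iic.2 hx)).trans hθU'
    change |(u₁ x - lam * (1 + (Λ / s₀ * Real.exp x) ^ 2 / 10 + (Λ / s₀ * Real.exp x) ^ 4 / 280 + (Λ / s₀ * Real.exp x) ^ 6 / 15120 + (Λ / s₀ * Real.exp x) ^ 8 / 1330560))| / (9 * N * Real.exp (-(ε * (x - xL)))) ≤ θ at h1
    rwa [div_le_iff₀ (hUbpos x)] at h1
  have hθZ : ∀ x, x ≤ xL → |((Λ * Real.exp x ^ 2 * S x * u₂ x / s₀ ^ 2) - Hf x - lam * (1 + (Λ / s₀ * Real.exp x) ^ 2 / 6 + (Λ / s₀ * Real.exp x) ^ 4 / 120 + (Λ / s₀ * Real.exp x) ^ 6 / 5040 + (Λ / s₀ * Real.exp x) ^ 8 / 362880 + (Λ / s₀ * Real.exp x) ^ 10 / 39916800))| ≤ θ * (17 / 10 * N * (401 / 100 - (Λ / s₀ * Real.exp x) ^ 2) * Real.exp (-(ε * (x - xL)))) := fun x hx => by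
    have h1 : gZ x ≤ θ := (hmZ (mem_Iic.2 hx)).trans hθZ'
    change |((Λ * Real.exp x ^ 2 * S x * u₂ x / s₀ ^ 2) - Hf x - lam * (1 + (Λ / s₀ * Real.exp x) ^ 2 / 6 + (Λ / s₀ * Real.exp x) ^ 4 / 120 + (Λ / s₀ * Real.exp x) ^ 6 / 5040 + (Λ / s₀ * Real.exp x) ^ 8 / 362880 + (Λ / s₀ * Real.exp x) ^ 10 / 39916800))| / (17 / 10 * N * (401 / 100 - (Λ / s₀ * Real.exp x) ^ 2) * Real.exp (-(ε * (x - xL)))) ≤ θ at h1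
    rwa [div_le_iff₀ (hZbpos x hx)] at h1
  have hθP : ∀ x, xL ≤ x → |u₁ x + 3 * u₂ x| ≤ θ * (N / Λ * (2 + 100 * S x) + η * Real.exp x) := fun x hx => by
    have h1 : gP x ≤ θ := (hmP (mem_Ici.2 hx)).trans hθP'
    change |u₁ x + 3 * u₂ x| / (N / Λ * (2 + 100 * S x) + η * Real.exp x) ≤ θ at h1
    rwa [div_le_iff₀ (hPbpos x)] at h1
  have hθM : ∀ x, xL ≤ x → |u₁ x - 3 * u₂ x| ≤ θ * (N / Λ * (2 + 75 * S x) + η * Real.exp x) := fun x hx => by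
    have h1 : gM x ≤ θ := (hmM (mem_Ici.2 hx)).trans hθM'
    change |u₁ x - 3 * u₂ x| / (N / Λ * (2 + 75 * S x) + η * Real.exp x) ≤ θ at h1
    rwa [div_le_iff₀ (hMbpos x)] at h1
  have hθPM : |u₁ xL + 3 * u₂ xL| + |u₁ xL - 3 * u₂ xL| ≤ θ * (N / Λ * (4 + 175 * S xL) + 2 * (η * Real.exp xL)) := by
    calc _ ≤ θ * (N / Λ * (2 + 100 * S xL) + η * Real.exp xL) + θ * (N / Λ * (2 + 75 * S xL) + η * Real.exp xL) :=
          add_le_add (hθP xL le_rfl) (hθM xL le_rfl)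
      _ = _ := by ring
  have hρL : Λ / s₀ * Real.exp xL = 2 := by rw [hxL]; field_simp
  have hθUL : |u₁ xL - lam * (15193 / 10395 : ℝ)| ≤ θ * (9 * N) := by
    have h1 := hθU xL le_rfl
    rw [hρL, sub_self, mul_zero, neg_zero, Real.exp_zero, mul_one] at h1
    have h2 : (1 + (2:ℝ) ^ 2 / 10 + (2:ℝ) ^ 4 / 280 + (2:ℝ) ^ 6 / 15120 + (2:ℝ) ^ 8 / 1330560) = 15193 / 10395 := bessel_values_two.2
    rwa [h2] at h1
  have hlamV : |lam| * (94253 / 51975) ≤ θ * (2918 / 100) * N := by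
    obtain ⟨-, -, -, -, hst1, hst2, hst0, -⟩ := inner_atoms_at hδΛ hδ hδ' hs₀ hs₀' hxL htc3 htd (le_refl xL)
    have heΛ : Real.exp xL * Λ = 2 * s₀ := by rw [hxL]; field_simp
    exact (packingResolventW_lamBound Λ δ s₀ N η θ (Real.exp xL) (S xL) (u₁ xL + 3 * u₂ xL) (u₁ xL - 3 * u₂ xL) lam
      hδΛ hδ hδ' hs₀ hs₀' heΛ hst1 hst2 hst0 hN hη.le (by linarith) hθ0 hθPM (by rw [hlam]; ring)).2
  -- ===== the case analysis: `θ ≤ 1` =====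
  have hinner := inner_cases r Λ δ s₀ N ε η θ lam xL W S u₁ u₂ f₁ f₂ Hf hr1 hr2 hδΛ hδ hδ' hs₀ hs₀' hxL hN hε hε' hη.le
    (by linarith) hθ0 hSpos hSd hu₁ hu₂ htc3 htd heq hf hHd hH0 hlam hθU hθZ hθPM
  have houter := outer_cases r Λ δ s₀ N η θ lam xL B₀ W S u₁ u₂ f₁ f₂ hr1 hδΛ hδ hδ' hB hΛB hs₀ hs₀' hxL hN hη.le hηN hθ0
    hSpos hSd hu₁ hu₂ htc htd hτ hsup hsub hB0 hSanti heq hf hlam hθP hθM hθUL hlamV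
  have hθ1 : θ ≤ 1 := by
    rcases max4_cases (gU xU) (gZ xZ) (gP xP) (gM xM) with hc | hc | hc | hc
    · refine hinner.1 xU hxU ?_
      have h1 : gU xU = θ := by rw [hθ_def, hc]
      change |(u₁ xU - lam * (1 + (Λ / s₀ * Real.exp xU) ^ 2 / 10 + (Λ / s₀ * Real.exp xU) ^ 4 / 280 + (Λ / s₀ * Real.exp xU) ^ 6 / 15120 + (Λ / s₀ * Real.exp xU) ^ 8 / 1330560))| / (9 * N * Real.exp (-(ε * (xU - xL)))) = θ at h1
      rw [div_eq_iff (hUbpos xU).ne'] at h1; exact h1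
    · refine hinner.2 xZ hxZ ?_
      have h1 : gZ xZ = θ := by rw [hθ_def, hc]
      change |((Λ * Real.exp xZ ^ 2 * S xZ * u₂ xZ / s₀ ^ 2) - Hf xZ - lam * (1 + (Λ / s₀ * Real.exp xZ) ^ 2 / 6 + (Λ / s₀ * Real.exp xZ) ^ 4 / 120 + (Λ / s₀ * Real.exp xZ) ^ 6 / 5040 + (Λ / s₀ * Real.exp xZ) ^ 8 / 362880 + (Λ / s₀ * Real.exp xZ) ^ 10 / 39916800))| / (17 / 10 * N * (401 / 100 - (Λ / s₀ * Real.exp xZ) ^ 2) * Real.exp (-(ε * (xZ - xL)))) = θ at h1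
      rw [div_eq_iff (hZbpos xZ hxZ).ne'] at h1; exact h1
    · refine houter.1 xP hxP ?_
      have h1 : gP xP = θ := by rw [hθ_def, hc]
      change |u₁ xP + 3 * u₂ xP| / (N / Λ * (2 + 100 * S xP) + η * Real.exp xP) = θ at h1
      rw [div_eq_iff (hPbpos xP).ne'] at h1; exact h1
    · refine houter.2 xM hxM ?_
      have h1 : gM xM = θ := by rw [hθ_def, hc]
      change |u₁ xM - 3 * u₂ xM| / (N / Λ * (2 + 75 * S xM) + η * Real.exp xM) = θ at h1
      rw [div_eq_iff (hMbpos xM).ne'] at h1; exact h1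
  -- ===== conclusion =====
  refine ⟨fun x hx => ⟨?_, ?_⟩, fun x hx => ⟨?_, ?_⟩⟩
  · exact (hθU x hx).trans (mul_le_of_le_one_left (hUbpos x).le hθ1)
  · exact (hθZ x hx).trans (mul_le_of_le_one_left (hZbpos x hx).le hθ1)
  · exact (hθP x hx).trans (mul_le_of_le_one_left (hPbpos x).le hθ1)
  · exact (hθM x hx).trans (mul_le_of_le_one_left (hMbpos x).le hθ1)

/-- `e^{εK} ≤ 1 + 2εK` for `0 ≤ K`, `0 < ε`, `εK ≤ 1` (the inner barriers' growth factor is `1 + O(ε)` at a fixed point).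
[folklore] -/
theorem expSmall (ε K : ℝ) (hε : 0 < ε) (hK : 0 ≤ K) (hεK : ε * K ≤ 1) : Real.exp (ε * K) ≤ 1 + 2 * (ε * K) := by
  have h0 : 0 ≤ ε * K := by positivity
  have h1 : |ε * K| ≤ 1 := by rw [abs_of_nonneg h0]; exact hεK
  have h2 := Real.abs_exp_sub_one_le h1
  rw [abs_of_nonneg h0] at h2
  have h3 := (abs_le.1 h2).2
  linarith

/-- **THE FOUR BARRIER BOUNDS WITH THE PARAMETERS REMOVED** (`ε, η → 0` in `packingResolventW_gauges`):
`|U| ≤ 9N`, `|Z| ≤ (17/10)N(4.01 − ρ²)` on `x ≤ x_Λ` and `|P| ≤ (N/Λ)(2 + 100S)`, `|M| ≤ (N/Λ)(2 + 75S)` on `x ≥ x_Λ`.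
[folklore] -/
theorem packingResolventW_gaugesLimit (r Λ δ s₀ N N' lam xL B₀ : ℝ) (W S u₁ u₂ f₁ f₂ Hf : ℝ → ℝ)
    (hr1 : 17307 / 15625 ≤ r) (hr2 : r ≤ 697 / 625) (hδΛ : δ * Λ = 1) (hδ : 0 < δ) (hδ' : δ ≤ 1 / 1000)
    (hB : 1 ≤ B₀) (hΛB : 700 * B₀ ^ 2 ≤ Λ)
    (hs₀ : 7 / 10 ≤ s₀) (hs₀' : s₀ ≤ 1) (hxL : Real.exp xL = 2 * s₀ / Λ) (hN : 0 < N)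
    (hSpos : ∀ x, 0 < S x) (hSd : Differentiable ℝ S)
    (hu₁ : Differentiable ℝ u₁) (hu₂ : Differentiable ℝ u₂)
    (htc : (∀ x, x ≤ 1 → |W x| ≤ 1 / 4 ∧ |deriv W x| ≤ 1 / 2 ∧ 7 / 10 ≤ Real.exp x * S x ∧ Real.exp x * S x ≤ 1))
    (htd : (∀ x, x ≤ 0 → |W x - (r - 1)| ≤ Real.exp x ^ 2 / 10 + 2 * Real.exp x ^ 4 ∧ |deriv W x| ≤ Real.exp x ^ 2 / 5 + 2 * Real.exp x ^ 4 ∧ |Real.exp x * S x - s₀| ≤ Real.exp x ^ 2 / 10 + 2 * Real.exp x ^ 4 ∧ |Real.exp x * (S x + deriv S x)| ≤ Real.exp x ^ 2 / 5 + 2 * Real.exp x ^ 4))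
    (hτ : ∀ x, x ≤ 0 → |S x + deriv S x| ≤ 11 / 5)
    (hsup : ∀ x, x < 0 → 1 < W x + S x) (hsub : ∀ x, 0 ≤ x → W x + S x ≤ 1)
    (hB0 : ∀ x, 0 ≤ x → |W x| ≤ B₀ ∧ |deriv W x| ≤ B₀ ∧ S x ≤ B₀ ∧ |deriv S x| ≤ B₀)
    (hSanti : ∀ x y, x ≤ y → y ≤ 1 → S y ≤ S x)
    (heq : ∀ x, Λ * u₁ x - ((W x - 1) * deriv u₁ x + 3 * S x * deriv u₂ x + (deriv W x + 2 * W x - r) * u₁ x + (3 * deriv S x + 6 * S x) * u₂ x) = f₁ x ∧ Λ * u₂ x - (S x / 3 * deriv u₁ x + (W x - 1) * deriv u₂ x + (deriv S x + 2 * S x) * u₁ x + (deriv W x / 3 + 2 * W x - r) * u₂ x) = f₂ x)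
    (hf : ∀ y, |f₁ y| / (1 + S y) + |f₂ y| / S y ≤ N)
    (hN' : ∀ y, |u₁ y| + |u₂ y| / S y ≤ N')
    (hHd : ∀ x, x ≤ xL → HasDerivAt Hf (-(Λ * Real.exp x ^ 2 * S x * ((1 - W x) * f₂ x + S x * f₁ x / 3)) / (s₀ ^ 2 * (S x ^ 2 - (1 - W x) ^ 2))) x ∧ |Hf x| ≤ 7 / 10 * N) (hH0 : Hf xL = 0)
    (hlam : lam * (94253 / 51975) = (Λ * Real.exp xL ^ 2 * S xL * u₂ xL / s₀ ^ 2)) :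
    (∀ x, x ≤ xL → |(u₁ x - lam * (1 + (Λ / s₀ * Real.exp x) ^ 2 / 10 + (Λ / s₀ * Real.exp x) ^ 4 / 280 + (Λ / s₀ * Real.exp x) ^ 6 / 15120 + (Λ / s₀ * Real.exp x) ^ 8 / 1330560))| ≤ 9 * N ∧ |((Λ * Real.exp x ^ 2 * S x * u₂ x / s₀ ^ 2) - Hf x - lam * (1 + (Λ / s₀ * Real.exp x) ^ 2 / 6 + (Λ / s₀ * Real.exp x) ^ 4 / 120 + (Λ / s₀ * Real.exp x) ^ 6 / 5040 + (Λ / s₀ * Real.exp x) ^ 8 / 362880 + (Λ / s₀ * Real.exp x) ^ 10 / 39916800))| ≤ 17 / 10 * N * (401 / 100 - (Λ / s₀ * Real.exp x) ^ 2)) ∧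
    (∀ x, xL ≤ x → |u₁ x + 3 * u₂ x| ≤ N / Λ * (2 + 100 * S x) ∧ |u₁ x - 3 * u₂ x| ≤ N / Λ * (2 + 75 * S x)) := by
  have key := fun (ε η : ℝ) (hε : 0 < ε) (hε' : ε ≤ 1 / 100) (hη : 0 < η) (hηN : η ≤ N / 100) =>
    packingResolventW_gauges r Λ δ s₀ N N' ε η lam xL B₀ W S u₁ u₂ f₁ f₂ Hf hr1 hr2 hδΛ hδ hδ' hB hΛB hs₀ hs₀' hxL hN hε hε'
      hη hηN hSpos hSd hu₁ hu₂ htc htd hτ hsup hsub hB0 hSanti heq hf hN' hHd hH0 hlam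
  have hN100 : 0 < N / 100 := by positivity
  constructor
  · intro x hx
    obtain ⟨K, hK⟩ : ∃ K : ℝ, K = xL - x := ⟨_, rfl⟩
    have hK0 : 0 ≤ K := by rw [hK]; linarith
    obtain ⟨t₀, ht₀⟩ : ∃ t : ℝ, t = min (1 / 100) (1 / (K + 1)) := ⟨_, rfl⟩
    have ht₀pos : 0 < t₀ := by rw [ht₀]; exact lt_min (by norm_num) (by positivity)
    have hexp : ∀ t : ℝ, 0 < t → t ≤ t₀ → Real.exp (-(t * (x - xL))) ≤ 1 + 2 * (t * K) := by
      intro t ht htt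
      have e1 : -(t * (x - xL)) = t * K := by rw [hK]; ring
      rw [e1]
      refine expSmall t K ht hK0 ?_
      have h1 : t ≤ 1 / (K + 1) := htt.trans (by rw [ht₀]; exact min_le_right _ _)
      rw [le_div_iff₀ (by positivity)] at h1
      nlinarith only [h1, ht.le, hK0]
    have hnn : 0 ≤ 17 / 10 * N * (401 / 100 - (Λ / s₀ * Real.exp x) ^ 2) := by
      have h1 := ((key (1 / 100) (N / 100) (by norm_num) le_rfl hN100 le_rfl).1 x hx).2
      have h2 : 0 < Real.exp (-(1 / 100 * (x - xL))) := Real.exp_pos _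
      by_contra hcon
      push Not at hcon
      have h3 : 17 / 10 * N * (401 / 100 - (Λ / s₀ * Real.exp x) ^ 2) * Real.exp (-(1 / 100 * (x - xL))) < 0 :=
        mul_neg_of_neg_of_pos hcon h2
      linarith [abs_nonneg ((Λ * Real.exp x ^ 2 * S x * u₂ x / s₀ ^ 2) - Hf x - lam * (1 + (Λ / s₀ * Real.exp x) ^ 2 / 6 + (Λ / s₀ * Real.exp x) ^ 4 / 120 + (Λ / s₀ * Real.exp x) ^ 6 / 5040 + (Λ / s₀ * Real.exp x) ^ 8 / 362880 + (Λ / s₀ * Real.exp x) ^ 10 / 39916800))]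
    constructor
    · refine packingResolventW_etaLimit _ _ (2 * (9 * N) * K) t₀ (by positivity) ht₀pos fun t ht htt => ?_
      have h1 := ((key t (N / 100) ht (htt.trans (by rw [ht₀]; exact min_le_left _ _)) hN100 le_rfl).1 x hx).1
      have h3 : 9 * N * Real.exp (-(t * (x - xL))) ≤ 9 * N * (1 + 2 * (t * K)) :=
        mul_le_mul_of_nonneg_left (hexp t ht htt) (by positivity)
      linarith
    · refine packingResolventW_etaLimit _ _ (2 * (17 / 10 * N * (401 / 100 - (Λ / s₀ * Real.exp x) ^ 2)) * K) t₀
        (by positivity) ht₀pos fun t ht htt => ?_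
      have h1 := ((key t (N / 100) ht (htt.trans (by rw [ht₀]; exact min_le_left _ _)) hN100 le_rfl).1 x hx).2
      have h3 : 17 / 10 * N * (401 / 100 - (Λ / s₀ * Real.exp x) ^ 2) * Real.exp (-(t * (x - xL))) ≤
          17 / 10 * N * (401 / 100 - (Λ / s₀ * Real.exp x) ^ 2) * (1 + 2 * (t * K)) :=
        mul_le_mul_of_nonneg_left (hexp t ht htt) hnn
      linarith
  · intro x hx
    constructor
    · refine packingResolventW_etaLimit _ _ (Real.exp x) (N / 100) (Real.exp_pos x).le hN100 fun t ht ht' => ?_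
      exact ((key (1 / 100) t (by norm_num) le_rfl ht ht').2 x hx).1
    · refine packingResolventW_etaLimit _ _ (Real.exp x) (N / 100) (Real.exp_pos x).le hN100 fun t ht ht' => ?_
      exact ((key (1 / 100) t (by norm_num) le_rfl ht ht').2 x hx).2

end Summit.AtomisticToContinuum.HydrodynamicLimit.Theorems.PackingAnalyticImplosion

end
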